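import Mathlib.RepresentationTheory.Continuous.Basic
import Mathlib.RepresentationTheory.Subrepresentation
import Mathlib.Analysis.InnerProductSpace.Adjoint
import Mathlib.Analysis.InnerProductSpace.Projection.Submodule
import Mathlib.Algebra.Star.Unitary
import Mathlib.Topology.Algebra.Module.ContinuousLinearMap.Restrict
import Mathlib.Topology.MetricSpace.IsometricSMul
import Mathlib.GroupTheory.GroupAction.DomAct.Basic
import Mathlib.Data.ENat.Lattice
import Mathlib.Order.Atoms
import Literature.Analysis.UnboundedOperators.UnitaryRep
import HarnessLib

-- provenance: harness21/H21/H21/Prelude/AutomorphicAxiomatic/HilbertRepSpectrum.lean @ a78fc8d (interim HEAD d8f2665); M5 mechanical rewrite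
/-!
# Hilbert-space representations: closed subrepresentations, discrete spectrum, multiplicity
(trunk G19 AutomorphicAxiomatic, item C10 `HilbertRepSpectrum`; notion `L2_discrete_spectrum`,
abstract half)

Vocabulary for (unitary) representations of a group `G` on a complex Hilbert space `H`, phrased on
Mathlib's `ContRepresentation ℂ G H` (a bare monoid homomorphism `G →* (H →L[ℂ] H)`):

* the predicates `π.IsUnitary`, `π.IsStronglyContinuous` and the bridge `π.toUnitaryRep` to the
  bundled `Literature.Analysis.UnboundedOperators.UnitaryRep` of trunk G07, with converses
  `Literature.Analysis.UnboundedOperators.UnitaryRep.isUnitary_toContRepresentation`,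
  `Literature.Analysis.UnboundedOperators.UnitaryRep.isStronglyContinuous_toContRepresentation`;
* closed invariant subspaces `ClosedSubrep π` (extending Mathlib's `Subrepresentation`), the
  sub-representation `W.toContRep`, orthogonal complements `W.orthogonal hπ` (for unitary `π`),
  closed spans `iSupClosure S`;
* topological irreducibility `IsTopIrreducible`, the *discrete part* `discretePart π` (closed span
  of the irreducible closed subrepresentations), `IsDiscretelyDecomposable`, unitary equivalence
  `AreUnitarilyEquivalent`, the multiplicity `multiplicity π σ : ℕ∞` of an irreducible `σ` in `π`
  and `HasMultiplicityOne`;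
* the constructor `ContRepresentation.ofIsometricSMul` turning an isometric action of the
  domain-action type `Gᵈᵐᵃ` (e.g. on `Lp`) into a representation of `G`, via
  `Literature.toDomMulAct : G →* Gᵈᵐᵃ`, `g ↦ DomMulAct.mk g⁻¹`.

Sources: J. Dixmier, *C\*-algebras* (North-Holland, 1977), §13 (unitary representations,
irreducibility, multiplicity) and §5.4 (isotypic components); N. R. Wallach, *Real Reductive
Groups I* (Academic Press, 1988), §1.4; G. B. Folland, *A Course in Abstract Harmonic Analysis*
(1995), §3.1.

## Mathlib

Mathlib (pinned) has `ContRepresentation` with `toRepresentation`, `invariants`, `Equiv`,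
`restrict` (restriction along a group homomorphism); `Subrepresentation` (with `SetLike`, `Lattice`,
`BoundedOrder`); `Representation.IsIrreducible := IsSimpleOrder (Subrepresentation ρ)` (algebraic
irreducibility, no topology); `unitary (H →L[ℂ] H)`, `Unitary.linearIsometryEquiv`,
`ContinuousLinearMap.norm_map_iff_adjoint_comp_self`, `IsUnit.mem_unitary_of_star_mul_self`;
`Submodule.orthogonal`, `Submodule.topologicalClosure`, `ContinuousLinearMap.restrict`;
`DomMulAct` and `IsIsometricSMul`. It has no closed subrepresentations, no topological
irreducibility, no discrete spectrum / multiplicity; everything below is a thin layer over these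
anchors.

## Design choices

* All declarations extending Mathlib's `ContRepresentation` live in `namespace ContRepresentation`
  as a deliberate dot-notation extension (so that `π.IsUnitary`, `π.discretePart`, `W.toContRep`
  read naturally); `toDomMulAct` lives in `namespace Literature`.
* `π` is *not* bundled as `Literature.Analysis.UnboundedOperators.UnitaryRep` from the start: the `L²` right-regular representation
  on `G ⧸ Γ` is unitary by construction but its strong continuity would come from Mathlib's
  `Lp.instContinuousSMulDomMulAct`, which needs `[R1Space X]`, unavailable for the relevant
  quotients. So unitarity / strong continuity are predicates and consumers call `toUnitaryRep`.
* `ClosedSubrep π extends Subrepresentation π.toRepresentation` by the field `isClosed'`; it gets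
  its own `SetLike`, `PartialOrder`, `⊥`, `⊤`, `BoundedOrder`; the full lattice structure is
  reached through the monotone map `toSubrepresentation`. The carrier type of `W.toContRep` is
  `↥W.toSubmodule` (as for Mathlib's `Subrepresentation.toRepresentation`), so that the
  `Submodule` instances (normed group, inner product space, completeness) apply verbatim.
* `IsTopIrreducible π := IsSimpleOrder (ClosedSubrep π)`, mirroring Mathlib's
  `Representation.IsIrreducible`; `isTopIrreducible_iff` unfolds it to
  `Nontrivial V ∧ ∀ W, W = ⊥ ∨ W = ⊤`.
* `multiplicity π σ` counts pairwise *orthogonal* irreducible closed subrepresentations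
  equivalent to `σ` (a supremum in `ℕ∞`); this is the right notion only for unitary `π`, which is
  the hypothesis of `hasMultiplicityOne_iff_multiplicity_le_one`.
* Generality: the purely topological notions (`IsStronglyContinuous`, `ClosedSubrep`, `toContRep`,
  `iSupClosure`, `IsTopIrreducible`, `discretePart`) are stated for a topological module over a
  ring; unitarity, orthogonal complements and multiplicities for complex Hilbert spaces.
-/

noncomputable section

open scoped InnerProductSpace ContRepresentation
open Topology

namespace ContRepresentation

/-! ### Strong continuity and closed subrepresentations (topological modules) -/

section TopologicalModule

variable {R G V : Type*} [Ring R] [Monoid G] [AddCommGroup V] [TopologicalSpace V]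
  [IsTopologicalAddGroup V] [Module R V]

/-- `π` is *strongly continuous*: every orbit map `g ↦ π g v` is continuous
(Folland (1995), §3.1; this is the continuity field of `Literature.Analysis.UnboundedOperators.StrongContRepresentation`). [cite: Folland1995] -/
def IsStronglyContinuous [TopologicalSpace G] (π : ContRepresentation R G V) : Prop :=
  ∀ v : V, Continuous fun g : G => π g v

/-- A *closed subrepresentation* of `π`: a closed `π`-invariant submodule of `V`
(Dixmier (1977), §13.1.2; Wallach (1988), §1.4). Extends Mathlib's `Subrepresentation`. [cite: Dixmier1977] -/
structure ClosedSubrep (π : ContRepresentation R G V)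
    extends Subrepresentation π.toRepresentation where
  /-- The carrier is closed. -/
  isClosed' : IsClosed (toSubmodule : Set V)

namespace ClosedSubrep

variable {π : ContRepresentation R G V}

/-- The forgetful map to Mathlib's `Subrepresentation` is injective (Dixmier (1977), §13.1.2). [cite: Dixmier1977] -/
theorem toSubrepresentation_injective :
    Function.Injective
      (toSubrepresentation : ClosedSubrep π → Subrepresentation π.toRepresentation) := by
  rintro ⟨_, _⟩ ⟨_, _⟩ h
  congr

/-- A closed subrepresentation is a set of vectors (Dixmier (1977), §13.1.2). [cite: Dixmier1977] -/
instance instSetLike : SetLike (ClosedSubrep π) V where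
  coe W := W.toSubmodule
  coe_injective := SetLike.coe_injective.comp
    (Subrepresentation.toSubmodule_injective.comp toSubrepresentation_injective)

/-- Closed subrepresentations are ordered by inclusion (Dixmier (1977), §13.1.2). [cite: Dixmier1977] -/
instance instPartialOrder : PartialOrder (ClosedSubrep π) := .ofSetLike (ClosedSubrep π) V

/-- A closed subrepresentation is in particular a submodule (Dixmier (1977), §13.1.2). [cite: Dixmier1977] -/
instance instCoeOutSubmodule : CoeOut (ClosedSubrep π) (Submodule R V) := ⟨fun W => W.toSubmodule⟩

/-- Unfolding the coercion to `Set V` (Dixmier (1977), §13.1.2). [cite: Dixmier1977] -/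
@[simp]
theorem coe_toSubmodule (W : ClosedSubrep π) : (W.toSubmodule : Set V) = W := rfl

/-- Membership in the underlying submodule (Dixmier (1977), §13.1.2). [cite: Dixmier1977] -/
@[simp]
theorem mem_toSubmodule {W : ClosedSubrep π} {v : V} : v ∈ W.toSubmodule ↔ v ∈ W := Iff.rfl

/-- Membership in the underlying `Subrepresentation` (Dixmier (1977), §13.1.2). [cite: Dixmier1977] -/
@[simp]
theorem mem_toSubrepresentation {W : ClosedSubrep π} {v : V} :
    v ∈ W.toSubrepresentation ↔ v ∈ W := Iff.rfl

/-- Two closed subrepresentations with the same vectors are equal (Dixmier (1977), §13.1.2). [cite: Dixmier1977] -/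
@[ext]
theorem ext {W W' : ClosedSubrep π} (h : ∀ v, v ∈ W ↔ v ∈ W') : W = W' := SetLike.ext h

/-- The carrier of a closed subrepresentation is closed (Dixmier (1977), §13.1.2). [cite: Dixmier1977] -/
theorem isClosed (W : ClosedSubrep π) : IsClosed (W : Set V) := W.isClosed'

/-- Invariance: `π g` maps `W` into `W` (Dixmier (1977), §13.1.2). [cite: Dixmier1977] -/
theorem apply_mem (W : ClosedSubrep π) (g : G) {v : V} (hv : v ∈ W) : π g v ∈ W :=
  W.apply_mem_toSubmodule g hv

/-- The order on closed subrepresentations is the one induced from `Subrepresentation`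
(Dixmier (1977), §13.1.2). [cite: Dixmier1977] -/
theorem toSubrepresentation_le_iff {W W' : ClosedSubrep π} :
    W.toSubrepresentation ≤ W'.toSubrepresentation ↔ W ≤ W' := Iff.rfl

/-- The order on closed subrepresentations is the one induced from `Submodule`
(Dixmier (1977), §13.1.2). [cite: Dixmier1977] -/
theorem toSubmodule_le_iff {W W' : ClosedSubrep π} :
    W.toSubmodule ≤ W'.toSubmodule ↔ W ≤ W' := Iff.rfl

/-- The forgetful map to `Subrepresentation` is monotone (Dixmier (1977), §13.1.2). [cite: Dixmier1977] -/
theorem toSubrepresentation_mono :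
    Monotone (toSubrepresentation : ClosedSubrep π → Subrepresentation π.toRepresentation) :=
  fun _ _ h => h

/-- The whole space as a closed subrepresentation (Dixmier (1977), §13.1.2). [cite: Dixmier1977] -/
instance instTop : Top (ClosedSubrep π) :=
  ⟨{ toSubrepresentation := ⊤, isClosed' := isClosed_univ }⟩

/-- The zero subrepresentation; closed as soon as points are closed (Dixmier (1977), §13.1.2). [cite: Dixmier1977] -/
instance instBot [T1Space V] : Bot (ClosedSubrep π) :=
  ⟨{ toSubrepresentation := ⊥
     isClosed' := by
       change IsClosed ((⊥ : Submodule R V) : Set V)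
       rw [Submodule.bot_coe]
       exact isClosed_singleton }⟩

/-- `⊤` has every vector (Dixmier (1977), §13.1.2). [cite: Dixmier1977] -/
@[simp]
theorem mem_top (v : V) : v ∈ (⊤ : ClosedSubrep π) := Set.mem_univ v

/-- The submodule underlying `⊤` is `⊤` (Dixmier (1977), §13.1.2). [cite: Dixmier1977] -/
@[simp]
theorem toSubmodule_top : (⊤ : ClosedSubrep π).toSubmodule = ⊤ := rfl

/-- `⊥` consists of `0` only (Dixmier (1977), §13.1.2). [cite: Dixmier1977] -/
@[simp]
theorem mem_bot [T1Space V] {v : V} : v ∈ (⊥ : ClosedSubrep π) ↔ v = 0 := Submodule.mem_bot R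

/-- The submodule underlying `⊥` is `⊥` (Dixmier (1977), §13.1.2). [cite: Dixmier1977] -/
@[simp]
theorem toSubmodule_bot [T1Space V] : (⊥ : ClosedSubrep π).toSubmodule = ⊥ := rfl

/-- `⊥ ≤ W ≤ ⊤` (Dixmier (1977), §13.1.2). [cite: Dixmier1977] -/
instance instBoundedOrder [T1Space V] : BoundedOrder (ClosedSubrep π) where
  le_top W := (le_top : W.toSubmodule ≤ ⊤)
  bot_le W := (bot_le : ⊥ ≤ W.toSubmodule)

/-- The representation of `G` on a closed invariant subspace `W`, obtained by restricting each
operator `π g` (Dixmier (1977), §13.1.2, *sous-représentation*). Not called `restrict`: in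
Mathlib's `ContRepresentation` namespace that name means restriction along a group homomorphism. [cite: Dixmier1977] -/
def toContRep (W : ClosedSubrep π) : ContRepresentation R G W.toSubmodule where
  toMonoidHom :=
  { toFun := fun g => (π g).restrict fun _ hv => W.apply_mem g hv
    map_one' := by ext; simp
    map_mul' := fun g h => by ext; simp }

/-- `W.toContRep g v = π g v` in `V` (Dixmier (1977), §13.1.2). [cite: Dixmier1977] -/
@[simp]
theorem coe_toContRep_apply (W : ClosedSubrep π) (g : G) (v : W.toSubmodule) :
    (W.toContRep g v : V) = π g v := rfl

/-- `W` is a *trivial* subrepresentation: `G` acts trivially on it, i.e. `W ≤ π.invariants`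
(Mathlib `ContRepresentation.invariants`; Dixmier (1977), §13.1). [cite: Dixmier1977] -/
def IsTrivialSubrep (W : ClosedSubrep π) : Prop := W.toSubmodule ≤ π.invariants

/-- The closed span `closure (⨆ W ∈ S, W)` of a family of closed subrepresentations is again a
closed subrepresentation: invariance passes to the algebraic span and then, by continuity of each
`π g`, to its closure (Dixmier (1977), §13.1.2). [cite: Dixmier1977] -/
def iSupClosure [ContinuousConstSMul R V] (S : Set (ClosedSubrep π)) : ClosedSubrep π where
  toSubmodule := (⨆ W ∈ S, (W : ClosedSubrep π).toSubmodule).topologicalClosure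
  apply_mem_toSubmodule g v hv := by
    set M : Submodule R V := ⨆ W ∈ S, (W : ClosedSubrep π).toSubmodule
    have hmaps : Set.MapsTo (π g) (M : Set V) (M : Set V) := by
      intro x hx
      have hle : M ≤ M.comap (π g : V →ₗ[R] V) :=
        iSup₂_le fun W hW x hx => Submodule.mem_comap.mpr
          ((le_iSup₂ (f := fun (W : ClosedSubrep π) (_ : W ∈ S) => W.toSubmodule) W hW)
            (W.apply_mem g hx))
      exact hle hx
    have hcl := hmaps.closure (π g).continuous
    rw [← Submodule.topologicalClosure_coe] at hcl
    exact hcl hv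
  isClosed' := Submodule.isClosed_topologicalClosure _

/-- Each member of the family lies below its closed span (Dixmier (1977), §13.1.2). [cite: Dixmier1977] -/
theorem le_iSupClosure [ContinuousConstSMul R V] {S : Set (ClosedSubrep π)} {W : ClosedSubrep π}
    (hW : W ∈ S) : W ≤ iSupClosure S := by
  intro v hv
  refine Submodule.le_topologicalClosure _ ?_
  exact (le_iSup₂ (f := fun (W : ClosedSubrep π) (_ : W ∈ S) => W.toSubmodule) W hW) hv

end ClosedSubrep

/-- `π` is *topologically irreducible*: `V ≠ 0` and the only closed invariant subspaces are `0`
and `V`; phrased as `IsSimpleOrder (ClosedSubrep π)` exactly like Mathlib's algebraic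
`Representation.IsIrreducible` (Dixmier (1977), §13.1.5; Wallach (1988), §1.4). [cite: Dixmier1977] -/
def IsTopIrreducible [T1Space V] (π : ContRepresentation R G V) : Prop :=
  IsSimpleOrder (ClosedSubrep π)

/-- Unfolding topological irreducibility: `V` is non-trivial and every closed subrepresentation
is `⊥` or `⊤` (Dixmier (1977), §13.1.5). [cite: Dixmier1977] -/
theorem isTopIrreducible_iff [T1Space V] (π : ContRepresentation R G V) :
    π.IsTopIrreducible ↔ Nontrivial V ∧ ∀ W : ClosedSubrep π, W = ⊥ ∨ W = ⊤ := by
  have key : ((⊥ : ClosedSubrep π) ≠ ⊤) ↔ Nontrivial V := by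
    rw [Ne, ClosedSubrep.ext_iff, not_forall, ← not_subsingleton_iff_nontrivial]
    simp only [ClosedSubrep.mem_bot, ClosedSubrep.mem_top, iff_true]
    constructor
    · rintro ⟨v, hv⟩ h
      exact hv (Subsingleton.elim v 0)
    · intro h
      by_contra hall
      push Not at hall
      exact h ⟨fun a b => (hall a).trans (hall b).symm⟩
  constructor
  · intro h
    haveI : IsSimpleOrder (ClosedSubrep π) := h
    exact ⟨key.mp bot_ne_top, fun W => IsSimpleOrder.eq_bot_or_eq_top W⟩
  · rintro ⟨h₁, h₂⟩
    exact { exists_pair_ne := ⟨⊥, ⊤, key.mpr h₁⟩, eq_bot_or_eq_top := h₂ }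

/-- The *discrete part* `V_disc` of `π`: the closed span of all topologically irreducible closed
subrepresentations (Dixmier (1977), §5.4 and §13; for `L²(Γ \ G)` this is the discrete spectrum,
Wallach (1988), §1.4). [cite: Dixmier1977] -/
def discretePart [T1Space V] [ContinuousConstSMul R V] (π : ContRepresentation R G V) :
    ClosedSubrep π :=
  ClosedSubrep.iSupClosure {W : ClosedSubrep π | W.toContRep.IsTopIrreducible}

/-- An irreducible closed subrepresentation lies in the discrete part (Dixmier (1977), §13). [cite: Dixmier1977] -/
theorem le_discretePart [T1Space V] [ContinuousConstSMul R V] {π : ContRepresentation R G V}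
    {W : ClosedSubrep π} (hW : W.toContRep.IsTopIrreducible) : W ≤ π.discretePart :=
  ClosedSubrep.le_iSupClosure hW

/-- `π` is *discretely decomposable*: it is the closed span of its irreducible closed
subrepresentations, `V_disc = V` (Dixmier (1977), §5.4; Wallach (1988), §1.4). [cite: Dixmier1977] -/
def IsDiscretelyDecomposable [T1Space V] [ContinuousConstSMul R V]
    (π : ContRepresentation R G V) : Prop :=
  π.discretePart = ⊤

end TopologicalModule

/-! ### Unitary equivalence (normed modules) -/

section Normed

variable {R G V V' : Type*} [Ring R] [Monoid G] [SeminormedAddCommGroup V] [Module R V]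
  [SeminormedAddCommGroup V'] [Module R V']

/-- `π` and `σ` are *unitarily equivalent*: there is an isometric equivalence of representations
`π ≃ σ` (Mathlib `ContRepresentation.Equiv` plus `Isometry`; Dixmier (1977), §13.1.3). [cite: Dixmier1977] -/
def AreUnitarilyEquivalent (π : ContRepresentation R G V) (σ : ContRepresentation R G V') :
    Prop :=
  ∃ e : π.Equiv σ, Isometry e

/-- Unitary equivalence is reflexive (Dixmier (1977), §13.1.3). [cite: Dixmier1977] -/
theorem AreUnitarilyEquivalent.refl (π : ContRepresentation R G V) :
    AreUnitarilyEquivalent π π :=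
  ⟨.refl π, isometry_id⟩

/-- Unitary equivalence is symmetric (Dixmier (1977), §13.1.3). [cite: Dixmier1977] -/
theorem AreUnitarilyEquivalent.symm {π : ContRepresentation R G V} {σ : ContRepresentation R G V'}
    (h : AreUnitarilyEquivalent π σ) : AreUnitarilyEquivalent σ π := by
  obtain ⟨e, he⟩ := h
  exact ⟨e.symm, he.right_inv e.right_inv⟩

end Normed

/-! ### Unitary representations on Hilbert spaces -/

section Hilbert

variable {G H H' : Type*} [Group G]
  [NormedAddCommGroup H] [InnerProductSpace ℂ H] [CompleteSpace H]
  [SeminormedAddCommGroup H'] [Module ℂ H']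

/-- `π` is *unitary*: every operator `π g` is a unitary of `H` (Mathlib `unitary (H →L[ℂ] H)`;
Dixmier (1977), §13.1.1; Folland (1995), §3.1). [cite: Dixmier1977] -/
def IsUnitary (π : ContRepresentation ℂ G H) : Prop := ∀ g : G, π g ∈ unitary (H →L[ℂ] H)

namespace IsUnitary

variable {π : ContRepresentation ℂ G H}

/-- Unitary operators are isometries: `‖π g x‖ = ‖x‖`
(Mathlib `ContinuousLinearMap.norm_map_of_mem_unitary`; Dixmier (1977), §13.1.1). [cite: Dixmier1977] -/
theorem norm_map (hπ : π.IsUnitary) (g : G) (x : H) : ‖π g x‖ = ‖x‖ :=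
  (π g).norm_map_of_mem_unitary (hπ g) x

/-- Unitary operators preserve inner products
(Mathlib `ContinuousLinearMap.inner_map_map_of_mem_unitary`; Dixmier (1977), §13.1.1). [cite: Dixmier1977] -/
theorem inner_map_map (hπ : π.IsUnitary) (g : G) (x y : H) : ⟪π g x, π g y⟫_ℂ = ⟪x, y⟫_ℂ :=
  (π g).inner_map_map_of_mem_unitary (hπ g) x y

/-- The adjoint of `π g` is `π g⁻¹` (Folland (1995), §3.1: `π(x⁻¹) = π(x)*`). [cite: Folland1995] -/
theorem adjoint_apply (hπ : π.IsUnitary) (g : G) :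
    ContinuousLinearMap.adjoint (π g) = π g⁻¹ :=
  calc ContinuousLinearMap.adjoint (π g) = star (π g) * (π g * π g⁻¹) := by
        rw [← map_mul, mul_inv_cancel, map_one, mul_one]; rfl
    _ = π g⁻¹ := by
        rw [← mul_assoc, Unitary.star_mul_self_of_mem (hπ g), one_mul]

end IsUnitary

/-- **Bridge to G07.** A strongly continuous unitary `ContRepresentation` bundled as an
`Literature.Analysis.UnboundedOperators.UnitaryRep` (Folland (1995), §3.1). [cite: Folland1995] -/
def toUnitaryRep [TopologicalSpace G] (π : ContRepresentation ℂ G H)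
    (h₁ : π.IsStronglyContinuous) (h₂ : π.IsUnitary) : Literature.Analysis.UnboundedOperators.UnitaryRep G H where
  toContRepresentation := π
  strongly_continuous := h₁
  mem_unitary := h₂

/-- The bundled representation has underlying `ContRepresentation` `π` (Folland (1995), §3.1). [cite: Folland1995] -/
@[simp]
theorem toUnitaryRep_toContRepresentation [TopologicalSpace G] (π : ContRepresentation ℂ G H)
    (h₁ : π.IsStronglyContinuous) (h₂ : π.IsUnitary) :
    (π.toUnitaryRep h₁ h₂).toContRepresentation = π := rfl

/-- The bundled representation acts by the same operators (Folland (1995), §3.1). [cite: Folland1995] -/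
@[simp]
theorem coe_toUnitaryRep [TopologicalSpace G] (π : ContRepresentation ℂ G H)
    (h₁ : π.IsStronglyContinuous) (h₂ : π.IsUnitary) : ⇑(π.toUnitaryRep h₁ h₂) = ⇑π := rfl

/-- The `ContRepresentation` underlying an `Literature.Analysis.UnboundedOperators.UnitaryRep` is unitary (Folland (1995), §3.1). [cite: Folland1995] -/
theorem _root_.Literature.Analysis.UnboundedOperators.UnitaryRep.isUnitary_toContRepresentation [TopologicalSpace G]
    (U : Literature.Analysis.UnboundedOperators.UnitaryRep G H) : U.toContRepresentation.IsUnitary :=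
  U.mem_unitary

/-- The `ContRepresentation` underlying an `Literature.Analysis.UnboundedOperators.UnitaryRep` is strongly continuous
(Folland (1995), §3.1). [cite: Folland1995] -/
theorem _root_.Literature.Analysis.UnboundedOperators.UnitaryRep.isStronglyContinuous_toContRepresentation [TopologicalSpace G]
    (U : Literature.Analysis.UnboundedOperators.UnitaryRep G H) : U.toContRepresentation.IsStronglyContinuous :=
  U.strongly_continuous

/-- Round trip: re-bundling the underlying `ContRepresentation` of `U` gives back `U`
(Folland (1995), §3.1). [cite: Folland1995] -/
@[simp]
theorem _root_.Literature.Analysis.UnboundedOperators.UnitaryRep.toUnitaryRep_toContRepresentation [TopologicalSpace G]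
    (U : Literature.Analysis.UnboundedOperators.UnitaryRep G H) :
    U.toContRepresentation.toUnitaryRep U.isStronglyContinuous_toContRepresentation
      U.isUnitary_toContRepresentation = U := rfl

namespace ClosedSubrep

variable {π : ContRepresentation ℂ G H}

/-- A closed subspace of a Hilbert space is complete (Mathlib `IsClosed.completeSpace_coe`);
recorded as an instance on the carrier of `W.toContRep` (Dixmier (1977), §13.1.2). [cite: Dixmier1977] -/
instance instCompleteSpace (W : ClosedSubrep π) : CompleteSpace W.toSubmodule :=
  W.isClosed.completeSpace_coe

/-- For unitary `π`, the orthogonal complement `Wᗮ` of a closed subrepresentation is again a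
closed subrepresentation: `⟪u, π g v⟫ = ⟪π g⁻¹ u, v⟫ = 0` for `u ∈ W`, `v ∈ Wᗮ`
(Dixmier (1977), §13.1.2; Folland (1995), §3.1). [cite: Dixmier1977] -/
def orthogonal (hπ : π.IsUnitary) (W : ClosedSubrep π) : ClosedSubrep π where
  toSubmodule := W.toSubmoduleᗮ
  apply_mem_toSubmodule g v hv := by
    change π g v ∈ W.toSubmoduleᗮ
    rw [Submodule.mem_orthogonal] at hv ⊢
    intro u hu
    rw [← ContinuousLinearMap.adjoint_inner_left, hπ.adjoint_apply g]
    exact hv _ (W.apply_mem g⁻¹ hu)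
  isClosed' := Submodule.isClosed_orthogonal _

/-- Membership in the orthogonal complement (Mathlib `Submodule.mem_orthogonal`). [folklore] -/
theorem mem_orthogonal_iff (hπ : π.IsUnitary) (W : ClosedSubrep π) (v : H) :
    v ∈ W.orthogonal hπ ↔ ∀ u ∈ W, ⟪u, v⟫_ℂ = 0 :=
  Submodule.mem_orthogonal _ v

/-- The submodule underlying `W.orthogonal hπ` is `Wᗮ` (Mathlib `Submodule.orthogonal`). [folklore] -/
@[simp]
theorem toSubmodule_orthogonal (hπ : π.IsUnitary) (W : ClosedSubrep π) :
    (W.orthogonal hπ).toSubmodule = W.toSubmoduleᗮ := rfl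

/-- `Wᗮᗮ = W` for a closed subrepresentation of a unitary representation
(Mathlib `Submodule.orthogonal_orthogonal`; Dixmier (1977), §13.1.2). [cite: Dixmier1977] -/
theorem orthogonal_orthogonal (hπ : π.IsUnitary) (W : ClosedSubrep π) :
    (W.orthogonal hπ).orthogonal hπ = W := by
  ext v
  change v ∈ W.toSubmoduleᗮᗮ ↔ v ∈ W
  rw [Submodule.orthogonal_orthogonal]
  rfl

end ClosedSubrep

/-- The *multiplicity* of `σ` in `π`: the supremum, in `ℕ∞`, of the sizes of finite families of
pairwise orthogonal, topologically irreducible closed subrepresentations of `π` each unitarily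
equivalent to `σ` (Dixmier (1977), §5.4 and §13; Wallach (1988), §1.4). Meaningful for unitary
`π` and irreducible `σ`. [cite: Dixmier1977] -/
def multiplicity (π : ContRepresentation ℂ G H) (σ : ContRepresentation ℂ G H') : ℕ∞ :=
  ⨆ (s : Finset (ClosedSubrep π))
    (_ : ∀ W ∈ s, W.toContRep.IsTopIrreducible ∧ AreUnitarilyEquivalent W.toContRep σ)
    (_ : (s : Set (ClosedSubrep π)).Pairwise fun W W' => W.toSubmodule ⟂ W'.toSubmodule),
    (s.card : ℕ∞)

/-- `π` has *multiplicity one*: two topologically irreducible closed subrepresentations of `π`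
that are unitarily equivalent coincide (Dixmier (1977), §5.4; multiplicity one for `GL n`,
Wallach (1988), §1.4). [cite: Dixmier1977] -/
def HasMultiplicityOne (π : ContRepresentation ℂ G H) : Prop :=
  ∀ W W' : ClosedSubrep π, W.toContRep.IsTopIrreducible → W'.toContRep.IsTopIrreducible →
    AreUnitarilyEquivalent W.toContRep W'.toContRep → W = W'

/-- For a unitary representation, multiplicity one is equivalent to every irreducible closed
subrepresentation occurring with multiplicity `≤ 1`. (`→`: orthogonal subrepresentations are
distinct; `←`: if `W ≠ W'` are equivalent irreducibles then `W ∩ W' = 0` and the polar part of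
the orthogonal projection `W' → Wᗮ` exhibits an irreducible in `Wᗮ` equivalent to `W`.)
Dixmier (1977), §5.4 and §13.1. [cite: Dixmier1977] -/
def hasMultiplicityOne_iff_multiplicity_le_one : Prop :=
  ∀ {π : ContRepresentation ℂ G H} (hπ : π.IsUnitary),
    π.HasMultiplicityOne ↔
      ∀ W : ClosedSubrep π, W.toContRep.IsTopIrreducible → π.multiplicity W.toContRep ≤ 1

end Hilbert

end ContRepresentation

/-! ### Representations from isometric domain actions -/

namespace Literature.NumberTheory.Automorphic

/-- The homomorphism `G →* Gᵈᵐᵃ`, `g ↦ DomMulAct.mk g⁻¹`. Mathlib's domain action of `Gᵈᵐᵃ` on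
functions is `(DomMulAct.mk c • f) x = f (c • x)`, a *right* action of `G`; precomposing with
`g ↦ g⁻¹` turns it into the left (regular) representation `(g • f) x = f (g⁻¹ • x)`
(Folland (1995), §3.1, left regular representation). [cite: Folland1995] -/
def toDomMulAct (G : Type*) [Group G] : G →* Gᵈᵐᵃ where
  toFun g := DomMulAct.mk g⁻¹
  map_one' := by simp
  map_mul' g h := by simp [mul_inv_rev, DomMulAct.mk_mul]

/-- `toDomMulAct G g = DomMulAct.mk g⁻¹` (Folland (1995), §3.1). [cite: Folland1995] -/
@[simp]
theorem toDomMulAct_apply (G : Type*) [Group G] (g : G) : toDomMulAct G g = DomMulAct.mk g⁻¹ :=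
  rfl

end Literature.NumberTheory.Automorphic

namespace ContRepresentation

section OfIsometricSMul

variable (R G M : Type*) [Ring R] [Group G] [SeminormedAddCommGroup M] [Module R M]
  [DistribMulAction Gᵈᵐᵃ M] [SMulCommClass Gᵈᵐᵃ R M] [IsIsometricSMul Gᵈᵐᵃ M]

/-- The representation of `G` on a normed `R`-module `M` carrying an isometric `R`-linear action of
the domain-action type `Gᵈᵐᵃ` (e.g. `M = Lp E p μ` for a measure-preserving action of `G`):
`π g f = DomMulAct.mk g⁻¹ • f`, each operator being `DistribSMul.toLinearMap` made continuous by
`continuous_const_smul` (Folland (1995), §3.1, regular representation). [cite: Folland1995] -/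
def ofIsometricSMul : ContRepresentation R G M where
  toMonoidHom :=
  { toFun := fun g => ⟨DistribSMul.toLinearMap R M (Literature.NumberTheory.Automorphic.toDomMulAct G g), continuous_const_smul _⟩
    map_one' := by ext; simp
    map_mul' := fun g h => by ext; simp [mul_smul] }

/-- `ofIsometricSMul R G M g f = DomMulAct.mk g⁻¹ • f` (Folland (1995), §3.1). [cite: Folland1995] -/
@[simp]
theorem ofIsometricSMul_apply (g : G) (f : M) :
    ofIsometricSMul R G M g f = DomMulAct.mk g⁻¹ • f := rfl

/-- Each operator of `ofIsometricSMul` is an isometry (Mathlib `isometry_smul`). [folklore] -/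
theorem isometry_ofIsometricSMul (g : G) : Isometry (ofIsometricSMul R G M g) :=
  isometry_smul M (DomMulAct.mk g⁻¹)

/-- Each operator of `ofIsometricSMul` preserves norms (Mathlib `isometry_smul`). [folklore] -/
theorem norm_ofIsometricSMul_apply (g : G) (f : M) : ‖ofIsometricSMul R G M g f‖ = ‖f‖ :=
  (AddMonoidHomClass.isometry_iff_norm _).mp (isometry_ofIsometricSMul R G M g) f

end OfIsometricSMul

section OfIsometricSMulHilbert

variable (G M : Type*) [Group G] [NormedAddCommGroup M] [InnerProductSpace ℂ M] [CompleteSpace M]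
  [DistribMulAction Gᵈᵐᵃ M] [SMulCommClass Gᵈᵐᵃ ℂ M] [IsIsometricSMul Gᵈᵐᵃ M]

/-- On a Hilbert space, `ofIsometricSMul` is a unitary representation: each operator is an
invertible isometry, hence unitary (Mathlib `IsUnit.mem_unitary_of_star_mul_self`,
`ContinuousLinearMap.norm_map_iff_adjoint_comp_self`; Folland (1995), §3.1). [cite: Folland1995] -/
theorem isUnitary_ofIsometricSMul : (ofIsometricSMul ℂ G M).IsUnitary := by
  intro g
  have hu : IsUnit (ofIsometricSMul ℂ G M g) :=
    (Group.isUnit g).map (ofIsometricSMul ℂ G M).toMonoidHom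
  exact hu.mem_unitary_of_star_mul_self
    ((ofIsometricSMul ℂ G M g).norm_map_iff_adjoint_comp_self.mp
      (norm_ofIsometricSMul_apply ℂ G M g))

end OfIsometricSMulHilbert

end ContRepresentation
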